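/-
Copyright: rh-split cell (screw, bridge) gen 17, 2026-08-27.  Splitting search over kernel-typed
RH-equivalences.  A splitting `A ∧ B ⟹ RH` is CONDITIONAL bookkeeping unless `A` and `B` are both
proved; nothing here bears on the truth of RH.
-/
import Summits.RiemannHypothesis.RiemannHypothesis.Theorems.Splittings.ScrewBlaschkeSeamA
import Summits.RiemannHypothesis.RiemannHypothesis.Theorems.Splittings.ScrewBlaschkeRigidity
import HarnessLib

/-!
# The KERNEL SEAM of row X-BL, carve B: the three series, inversion, and `blaschkeTransparency`
(CARVE B of `ScrewBlaschkeSeam`: §§3–4; see carve A `ScrewBlaschkeSeamA` for the module documentation and §§1–2.)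

Main results: `blaschkeTransparency (hh : 0 < h) : BlaschkeTransparency h` (`CEIL(h) ∧ TBL ⟹ RH`), the unconditional
row `latticeCeiling_and_topBlaschke_iff_rh : (CEIL(h) ∧ TopBlaschke) ↔ RiemannHypothesis`, its disjunctive form with
`MaxRe`, and the RH-free readings `nonBlaschkeResidue`, `latticeCeiling_dichotomy_nonBlaschke`.

No `sorry`, no new axioms, no instances, no notation.
-/

set_option linter.dupNamespace false

namespace Summit.RiemannHypothesis.RiemannHypothesis.Theorems.Splittings.ScrewBlaschkeSeam

open Complex Filter Topology Set Metric
open scoped ComplexConjugate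
open Literature.NumberTheory.LFunctions
open ZetaZeros.riemannZetaNontrivialZeros
open Summit.RiemannHypothesis.RiemannHypothesis.Theorems.Splittings
open Summit.RiemannHypothesis.RiemannHypothesis.Theorems.Splittings.ScrewBorel
open Summit.RiemannHypothesis.RiemannHypothesis.Theorems.Splittings.ScrewLatticeContinuation
open Summit.RiemannHypothesis.RiemannHypothesis.Theorems.Splittings.ScrewBlaschkeTop
open Summit.RiemannHypothesis.RiemannHypothesis.Theorems.Splittings.ScrewBlaschkeRigidity

/-! ## 3. The three series: `P = ∑_TOP polar`, `G = ∑_TOP regular`, `B_rest = ∑_REST term`, and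
`H = P_h - B_rest - G` -/

/-- `P(z) = ∑_TOP (c_ρ/2)(1 - z/p_ρ)⁻¹`. -/
noncomputable def Ppart (h δ : ℝ) (z : ℂ) : ℂ := ∑' ρ : topSet δ, polar (coeff ρ) (pole h ρ) z

/-- `G(z) = ∑_TOP c_ρ((1/2)(1 - p_ρ z)⁻¹ - (1 - z)⁻¹)`. -/
noncomputable def Gpart (h δ : ℝ) (z : ℂ) : ℂ := ∑' ρ : topSet δ, regular (coeff ρ) (pole h ρ) z

/-- `B_rest(z) = ∑_REST term(c_ρ, u_ρ)(z)`. -/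
noncomputable def Brest (h δ : ℝ) (z : ℂ) : ℂ :=
  ∑' ρ : ((topSet δ)ᶜ : Set ZetaZeros.riemannZetaNontrivialZeros), term (coeff ρ) (mult h ρ) z

/-- `H = P_h - B_rest - G`. -/
noncomputable def Hfun (h δ : ℝ) (z : ℂ) : ℂ := latticeGF h z - Brest h δ z - Gpart h δ z

/-- The polar series converges absolutely on the core `‖z‖ < r*`. -/
theorem summable_polar {h δ : ℝ} (hh : 0 < h)
    (hlt : ∀ ρ : ℂ, ρ ∈ ZetaZeros.riemannZetaNontrivialZeros → ρ.re < supRe) {z : ℂ}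
    (hz : ‖z‖ < rstar h) : Summable fun ρ : topSet δ ↦ polar (coeff ρ) (pole h ρ) z :=
  Summable.of_norm_bounded ((summable_norm_coeff.subtype _).div_const (1 - ‖z‖ / rstar h))
    fun ρ ↦ norm_polar_le (rstar_pos h) hz le_rfl (rstar_lt_norm_pole hh hlt ρ).le

/-- The regular series converges absolutely on the disc. -/
theorem summable_regular {h δ : ℝ} (hh : 0 ≤ h) {z : ℂ} (hz : ‖z‖ < 1) :
    Summable fun ρ : topSet δ ↦ regular (coeff ρ) (pole h ρ) z :=
  Summable.of_norm_bounded (((summable_norm_coeff.subtype _).mul_left 2).div_const (1 - ‖z‖))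
    fun ρ ↦ norm_regular_le hz le_rfl (norm_pole_le_one hh ρ)

/-- The full Borel family is absolutely summable on `‖z‖ < e^{-h/2}` (all in-disc poles have modulus
`≥ e^{-h/2}`). -/
theorem summable_term {h : ℝ} (hh : 0 < h) {z : ℂ} (hz : ‖z‖ < Real.exp (-(h / 2))) :
    Summable fun ρ : ZetaZeros.riemannZetaNontrivialZeros ↦ term (coeff ρ) (mult h ρ) z := by
  set d : ℝ := Real.exp (-(h / 2)) - ‖z‖ with hd
  have hd0 : 0 < d := by rw [hd]; linarith
  have hdr : d ≤ 1 - ‖z‖ := by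
    have : Real.exp (-(h / 2)) ≤ 1 := by rw [Real.exp_le_one_iff]; linarith
    rw [hd]; linarith
  have hfar₁ : ∀ ρ : ZetaZeros.riemannZetaNontrivialZeros, ‖(mult h ρ)⁻¹‖ < 1 →
      d ≤ ‖(mult h ρ)⁻¹ - z‖ := by
    intro ρ hu
    have hge := exp_neg_half_le_norm_of_mem hh.le (p := (mult h ρ)⁻¹) ⟨hu, ρ, Or.inr rfl⟩
    have := norm_sub_norm_le (mult h ρ)⁻¹ z
    rw [hd]; linarith
  have hfar₂ : ∀ ρ : ZetaZeros.riemannZetaNontrivialZeros, ‖mult h ρ‖ < 1 →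
      d ≤ ‖mult h ρ - z‖ := by
    intro ρ hu
    have hge := exp_neg_half_le_norm_of_mem hh.le (p := mult h ρ) ⟨hu, ρ, Or.inl rfl⟩
    have := norm_sub_norm_le (mult h ρ) z
    rw [hd]; linarith
  exact Summable.of_norm_bounded ((summable_norm_coeff.mul_left 2).div_const d)
    fun ρ ↦ norm_term_le (mult_ne_zero h ρ) hd0 hdr le_rfl (hfar₁ ρ) (hfar₂ ρ)

/-- **`P` is holomorphic on the core `‖z‖ < r*`.** -/
theorem differentiableOn_Ppart {h δ : ℝ} (hh : 0 < h)
    (hlt : ∀ ρ : ℂ, ρ ∈ ZetaZeros.riemannZetaNontrivialZeros → ρ.re < supRe) :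
    DifferentiableOn ℂ (Ppart h δ) (ball 0 (rstar h)) := by
  refine differentiableOn_ball_of_forall_lt fun R' hR' ↦ ?_
  have hr := rstar_pos h
  have hgap : 0 < 1 - R' / rstar h := by
    rw [sub_pos, div_lt_one hr]
    exact hR'
  have hzR : ∀ z ∈ ball (0 : ℂ) R', ‖z‖ ≤ R' := fun z hz ↦ (mem_ball_zero_iff.1 hz).le
  show DifferentiableOn ℂ (fun z ↦ ∑' ρ : topSet δ, polar (coeff ρ) (pole h ρ) z) (ball 0 R')
  refine differentiableOn_tsum_of_summable_norm
    (u := fun ρ : topSet δ ↦ ‖coeff ρ‖ / (1 - R' / rstar h))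
    ((summable_norm_coeff.subtype _).div_const _) (fun ρ z hz ↦ ?_) isOpen_ball
    (fun ρ z hz ↦ norm_polar_le hr hR' (hzR z hz) (rstar_lt_norm_pole hh hlt ρ).le)
  have hp := (rstar_lt_norm_pole hh hlt ρ).le
  have hR'0 : 0 ≤ R' := (norm_nonneg z).trans (hzR z hz)
  have h1 : ‖z / pole h ρ‖ ≤ R' / rstar h := by
    rw [norm_div]
    calc ‖z‖ / ‖pole h ρ‖ ≤ R' / ‖pole h ρ‖ := by gcongr; exact hzR z hz
      _ ≤ R' / rstar h := by gcongr
  have e1 := one_sub_le_norm_one_sub h1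
  have n1 : 1 - z / pole h ρ ≠ 0 := fun h0 ↦ by rw [h0, norm_zero] at e1; linarith
  exact (differentiableAt_polar n1).differentiableWithinAt

/-- **`G` is holomorphic on the unit disc** (`h ≥ 0`). -/
theorem differentiableOn_Gpart {h δ : ℝ} (hh : 0 ≤ h) :
    DifferentiableOn ℂ (Gpart h δ) (ball 0 1) := by
  refine differentiableOn_ball_of_forall_lt fun R' hR' ↦ ?_
  have hgap : 0 < 1 - R' := by linarith
  have hzR : ∀ z ∈ ball (0 : ℂ) R', ‖z‖ ≤ R' := fun z hz ↦ (mem_ball_zero_iff.1 hz).le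
  show DifferentiableOn ℂ (fun z ↦ ∑' ρ : topSet δ, regular (coeff ρ) (pole h ρ) z) (ball 0 R')
  refine differentiableOn_tsum_of_summable_norm
    (u := fun ρ : topSet δ ↦ 2 * ‖coeff ρ‖ / (1 - R'))
    (((summable_norm_coeff.subtype _).mul_left 2).div_const _) (fun ρ z hz ↦ ?_) isOpen_ball
    (fun ρ z hz ↦ norm_regular_le hR' (hzR z hz) (norm_pole_le_one hh ρ))
  have h1 : ‖pole h ρ * z‖ ≤ R' := by
    rw [norm_mul]
    calc ‖pole h ρ‖ * ‖z‖ ≤ 1 * R' := by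
          gcongr
          · exact norm_pole_le_one hh ρ
          · exact hzR z hz
      _ = R' := one_mul _
  have e1 := one_sub_le_norm_one_sub h1
  have e2 := one_sub_le_norm_one_sub (hzR z hz)
  have n1 : 1 - pole h ρ * z ≠ 0 := fun h0 ↦ by rw [h0, norm_zero] at e1; linarith
  have n2 : 1 - z ≠ 0 := fun h0 ↦ by rw [h0, norm_zero] at e2; linarith
  exact (differentiableAt_regular n1 n2).differentiableWithinAt

/-- **`B_rest` is holomorphic on `‖z‖ < R₁`** (`h > 0`, `δ ≤ Θ - 1/2`): the in-disc poles of the REST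
terms have modulus `≥ R₁`. -/
theorem differentiableOn_Brest {h δ : ℝ} (hh : 0 < h) (hδ : δ ≤ supRe - 1 / 2) :
    DifferentiableOn ℂ (Brest h δ) (ball 0 (outerR h δ)) := by
  have hR1 := outerR_le_one hh.le hδ
  refine differentiableOn_ball_of_forall_lt fun R' hR' ↦ ?_
  set d : ℝ := outerR h δ - R' with hd
  have hd0 : 0 < d := by rw [hd]; linarith
  have hdr : d ≤ 1 - R' := by rw [hd]; linarith
  have hzR : ∀ z ∈ ball (0 : ℂ) R', ‖z‖ ≤ R' := fun z hz ↦ (mem_ball_zero_iff.1 hz).le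
  have hfar₁ : ∀ z ∈ ball (0 : ℂ) R', ∀ ρ : ((topSet δ)ᶜ : Set ZetaZeros.riemannZetaNontrivialZeros),
      ‖(mult h ρ)⁻¹‖ < 1 → d ≤ ‖(mult h ρ)⁻¹ - z‖ := by
    intro z hz ρ hu
    have hp : pole h ρ = (mult h ρ)⁻¹ := pole_eq_inv_of_norm_inv_lt hh hu
    have hge : outerR h δ ≤ ‖(mult h ρ)⁻¹‖ := hp ▸ outerR_le_norm_pole hh.le ρ.2
    have := norm_sub_norm_le (mult h ρ)⁻¹ z
    have := hzR z hz
    rw [hd]; linarith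
  have hfar₂ : ∀ z ∈ ball (0 : ℂ) R', ∀ ρ : ((topSet δ)ᶜ : Set ZetaZeros.riemannZetaNontrivialZeros),
      ‖mult h ρ‖ < 1 → d ≤ ‖mult h ρ - z‖ := by
    intro z hz ρ hu
    have hp : pole h ρ = mult h ρ := pole_eq_of_norm_lt hh hu
    have hge : outerR h δ ≤ ‖mult h ρ‖ := hp ▸ outerR_le_norm_pole hh.le ρ.2
    have := norm_sub_norm_le (mult h ρ) z
    have := hzR z hz
    rw [hd]; linarith
  show DifferentiableOn ℂ (fun z ↦ ∑' ρ : ((topSet δ)ᶜ : Set ZetaZeros.riemannZetaNontrivialZeros),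
    term (coeff ρ) (mult h ρ) z) (ball 0 R')
  refine differentiableOn_tsum_of_summable_norm
    (u := fun ρ : ((topSet δ)ᶜ : Set ZetaZeros.riemannZetaNontrivialZeros) ↦ 2 * ‖coeff ρ‖ / d)
    (((summable_norm_coeff.subtype _).mul_left 2).div_const d) (fun ρ z hz ↦ ?_) isOpen_ball
    (fun ρ z hz ↦ norm_term_le (mult_ne_zero h ρ) hd0 hdr (hzR z hz) (hfar₁ z hz ρ) (hfar₂ z hz ρ))
  have e1 := le_norm_one_sub_mul (mult_ne_zero h ρ) hdr (hzR z hz) (hfar₁ z hz ρ)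
  have e2 := le_norm_one_sub_div (mult_ne_zero h ρ) hdr (hzR z hz) (hfar₂ z hz ρ)
  have e3 := hdr.trans (one_sub_le_norm_one_sub (hzR z hz))
  have n1 : 1 - mult h ρ * z ≠ 0 := fun h0 ↦ by rw [h0, norm_zero] at e1; linarith
  have n2 : 1 - z / mult h ρ ≠ 0 := fun h0 ↦ by rw [h0, norm_zero] at e2; linarith
  have n3 : 1 - z ≠ 0 := fun h0 ↦ by rw [h0, norm_zero] at e3; linarith
  exact (differentiableAt_term n1 n2 n3).differentiableWithinAt

/-- **`H` is holomorphic on `‖z‖ < R₁` under `CEIL(h)`.** -/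
theorem differentiableOn_Hfun {h δ : ℝ} (hh : 0 < h) (hδ : δ ≤ supRe - 1 / 2)
    (hceil : LatticeCeiling h) : DifferentiableOn ℂ (Hfun h δ) (ball 0 (outerR h δ)) := by
  have hR1 := outerR_le_one hh.le hδ
  show DifferentiableOn ℂ (fun z ↦ latticeGF h z - Brest h δ z - Gpart h δ z) (ball 0 (outerR h δ))
  exact (((differentiableOn_latticeGF hceil).mono (ball_subset_ball hR1)).sub
    (differentiableOn_Brest hh hδ)).sub ((differentiableOn_Gpart hh.le).mono (ball_subset_ball hR1))

/-- **Near `0`, `H = P`** (`‖z‖ < e^{-h/2}`): `P_h = ∑ term = ∑_TOP (polar + regular) + ∑_REST term`. -/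
theorem Hfun_eq_Ppart_of_small {h δ : ℝ} (hh : 0 < h)
    (hlt : ∀ ρ : ℂ, ρ ∈ ZetaZeros.riemannZetaNontrivialZeros → ρ.re < supRe) {z : ℂ}
    (hz : ‖z‖ < Real.exp (-(h / 2))) : Hfun h δ z = Ppart h δ z := by
  have hz1 : ‖z‖ < 1 := hz.trans_le (by rw [Real.exp_le_one_iff]; linarith)
  have hzr : ‖z‖ < rstar h := hz.trans_le (exp_neg_half_le_rstar hh.le)
  have hsum := summable_term hh hz
  have e1 := latticeGF_eq_borel hh hz
  have e2 := (hsum.tsum_subtype_add_tsum_subtype_compl (topSet δ)).symm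
  have hpol := summable_polar (δ := δ) hh hlt hzr
  have hreg := summable_regular (δ := δ) hh.le hz1
  have e3 : ∑' ρ : topSet δ, term (coeff ρ) (mult h ρ) z = Ppart h δ z + Gpart h δ z := by
    rw [Ppart, Gpart, ← hpol.tsum_add hreg]
    exact tsum_congr fun ρ ↦ term_eq_polar_add_regular (pole_eq_or h ρ) z
  unfold Hfun Brest
  rw [e1, e2, e3]
  ring

/-- **`H = P` on the whole core `‖z‖ < r*`** (identity theorem; `0 < δ ≤ Θ - 1/2`, `CEIL(h)`). -/
theorem Hfun_eq_Ppart {h δ : ℝ} (hh : 0 < h) (hδ0 : 0 ≤ δ) (hδ : δ ≤ supRe - 1 / 2)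
    (hlt : ∀ ρ : ℂ, ρ ∈ ZetaZeros.riemannZetaNontrivialZeros → ρ.re < supRe)
    (hceil : LatticeCeiling h) : EqOn (Hfun h δ) (Ppart h δ) (ball 0 (rstar h)) := by
  have hH : AnalyticOnNhd ℂ (Hfun h δ) (ball 0 (rstar h)) :=
    ((differentiableOn_Hfun hh hδ hceil).mono
      (ball_subset_ball (rstar_le_outerR hh.le hδ0))).analyticOnNhd isOpen_ball
  have hP : AnalyticOnNhd ℂ (Ppart h δ) (ball 0 (rstar h)) :=
    (differentiableOn_Ppart hh hlt).analyticOnNhd isOpen_ball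
  have h0 : (0 : ℂ) ∈ ball (0 : ℂ) (rstar h) := mem_ball_self (rstar_pos h)
  have hev : Hfun h δ =ᶠ[𝓝 0] Ppart h δ := by
    have hmem : ball (0 : ℂ) (Real.exp (-(h / 2))) ∈ 𝓝 (0 : ℂ) :=
      isOpen_ball.mem_nhds (mem_ball_self (Real.exp_pos _))
    exact Filter.eventuallyEq_of_mem hmem fun z hz ↦
      Hfun_eq_Ppart_of_small hh hlt (mem_ball_zero_iff.1 hz)
  exact hH.eqOn_of_preconnected_of_eventuallyEq hP (convex_ball 0 (rstar h)).isPreconnected h0 hev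

/-! ## 4. Inversion `w = r*/z` and the contradiction -/

/-- The inverted outside function `g(w) = H(r*/w)` is holomorphic on `‖w‖ > e^{-δ h}`. -/
theorem differentiableOn_g {h δ : ℝ} (hh : 0 < h) (hδ : δ ≤ supRe - 1 / 2) (hceil : LatticeCeiling h) :
    DifferentiableOn ℂ (fun w ↦ Hfun h δ ((rstar h : ℂ) / w))
      {w : ℂ | Real.exp (-(δ * h)) < ‖w‖} := by
  intro w hw
  have hw' : Real.exp (-(δ * h)) < ‖w‖ := hw
  have hwpos : 0 < ‖w‖ := (Real.exp_pos _).trans hw'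
  have hw0 : w ≠ 0 := norm_pos_iff.1 hwpos
  have hz : (rstar h : ℂ) / w ∈ ball (0 : ℂ) (outerR h δ) := by
    rw [mem_ball_zero_iff, norm_div, Complex.norm_real, Real.norm_eq_abs, abs_of_pos (rstar_pos h),
      ← rstar_div_exp h δ]
    exact div_lt_div_of_pos_left (rstar_pos h) (Real.exp_pos _) hw'
  have hH := (differentiableOn_Hfun hh hδ hceil).differentiableAt (isOpen_ball.mem_nhds hz)
  have hdiv : DifferentiableAt ℂ (fun w : ℂ ↦ (rstar h : ℂ) / w) w :=
    (differentiableAt_const _).div differentiableAt_id hw0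
  exact (hH.comp w hdiv).differentiableWithinAt

/-- **The Borel expansion of `g` outside the unit circle**: for `‖w‖ > 1`,
`∑_TOP (c_ρ w_ρ/2)/(w - w_ρ) = g(w) - ∑_TOP c_ρ/2`. -/
theorem hasSum_g {h δ : ℝ} (hh : 0 < h) (hδ0 : 0 ≤ δ) (hδ : δ ≤ supRe - 1 / 2)
    (hlt : ∀ ρ : ℂ, ρ ∈ ZetaZeros.riemannZetaNontrivialZeros → ρ.re < supRe)
    (hceil : LatticeCeiling h) {w : ℂ} (hw : 1 < ‖w‖) :
    HasSum (fun ρ : topSet δ ↦ coeff ρ * wp h ρ / 2 / (w - wp h ρ))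
      (Hfun h δ ((rstar h : ℂ) / w) - ∑' ρ : topSet δ, coeff ρ / 2) := by
  have hwpos : 0 < ‖w‖ := zero_lt_one.trans hw
  have hw0 : w ≠ 0 := norm_pos_iff.1 hwpos
  have hz : ‖(rstar h : ℂ) / w‖ < rstar h := by
    rw [norm_div, Complex.norm_real, Real.norm_eq_abs, abs_of_pos (rstar_pos h)]
    exact div_lt_self (rstar_pos h) hw
  have hzb : (rstar h : ℂ) / w ∈ ball (0 : ℂ) (rstar h) := mem_ball_zero_iff.2 hz
  rw [Hfun_eq_Ppart hh hδ0 hδ hlt hceil hzb]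
  have hpol := summable_polar (δ := δ) hh hlt hz
  have h1 : HasSum (fun ρ : topSet δ ↦ polar (coeff ρ) (pole h ρ) ((rstar h : ℂ) / w))
      (Ppart h δ ((rstar h : ℂ) / w)) := hpol.hasSum
  have hne : ∀ ρ : topSet δ, w ≠ wp h ρ := fun ρ e ↦ by
    have := norm_wp_lt_one hh hlt ρ
    rw [← e] at this
    linarith
  have e : (fun ρ : topSet δ ↦ polar (coeff ρ) (pole h ρ) ((rstar h : ℂ) / w)) =
      fun ρ : topSet δ ↦ coeff ρ / 2 + coeff ρ * wp h ρ / 2 / (w - wp h ρ) := by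
    funext ρ
    exact polar_inv_eq (pole_ne_zero h ρ) hw0 (hne ρ)
  rw [e] at h1
  have h2 : HasSum (fun ρ : topSet δ ↦ coeff ρ / 2) (∑' ρ : topSet δ, coeff ρ / 2) :=
    ((Summable.of_norm (summable_norm_coeff.subtype (topSet δ))).div_const 2).hasSum
  have h3 := h1.sub h2
  have e' : (fun ρ : topSet δ ↦ coeff ρ / 2 + coeff ρ * wp h ρ / 2 / (w - wp h ρ) - coeff ρ / 2) =
      fun ρ : topSet δ ↦ coeff ρ * wp h ρ / 2 / (w - wp h ρ) := by
    funext ρ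
    ring
  rw [e'] at h3
  exact h3

/-- **T-BL(h) in the kernel**: `CEIL(h) ∧ TBL ⟹ RH` (`h > 0`). -/
theorem blaschkeTransparency {h : ℝ} (hh : 0 < h) : BlaschkeTransparency h := by
  intro hceil htbl
  by_contra hRH
  obtain ⟨δ₀, hδ₀, hBL₀⟩ := htbl
  rcases latticeCeiling_dichotomy_top hh hceil with hrh | ⟨hΘ, hlt, -⟩
  · exact hRH hrh
  -- the width `δ = min δ₀ (Θ - 1/2)`
  set δ : ℝ := min δ₀ (supRe - 1 / 2) with hδdef
  have hδ : 0 < δ := lt_min hδ₀ (by linarith)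
  have hδΘ : δ ≤ supRe - 1 / 2 := min_le_right _ _
  have hBL : BlaschkeTop δ := blaschkeTop_mono (min_le_left _ _) hBL₀
  have hceil' : LatticeCeiling h := hceil
  -- a zero in the top layer
  obtain ⟨ρ₁, hρ₁, hβ₁⟩ := exists_lt_re_of_lt_supRe (show supRe - δ < supRe by linarith)
  have htop₁ : (⟨ρ₁, hρ₁⟩ : ZetaZeros.riemannZetaNontrivialZeros) ∈ topSet δ := by
    show supRe - 1 / 2 - δ < |ρ₁.re - 1 / 2|
    exact lt_of_lt_of_le (by linarith) (le_abs_self _)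
  set ρ₁' : topSet δ := ⟨⟨ρ₁, hρ₁⟩, htop₁⟩ with hρ₁'
  set a : ℂ := wp h ((ρ₁' : topSet δ) : ZetaZeros.riemannZetaNontrivialZeros) with ha_def
  have ha : Real.exp (-(δ * h)) < ‖a‖ := exp_neg_lt_norm_wp hh ρ₁'.2
  have ha1 : ‖a‖ < 1 := norm_wp_lt_one hh hlt _
  have ha0 : a ≠ 0 := norm_pos_iff.1 ((Real.exp_pos _).trans ha)
  -- countability of the index
  haveI : Countable ZetaZeros.riemannZetaNontrivialZeros := riemannZetaNontrivialZeros_countable.to_subtype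
  -- the coefficients `b_ρ = c_ρ w_ρ / 2` are ℓ¹
  have hb : Summable fun ρ : topSet δ ↦ ‖coeff ρ * wp h ρ / 2‖ := by
    refine Summable.of_nonneg_of_le (fun _ ↦ norm_nonneg _) (fun ρ ↦ ?_)
      (summable_norm_coeff.subtype (topSet δ))
    rw [norm_div, norm_mul]
    have : ‖(2 : ℂ)‖ = 2 := by simp
    rw [this]
    have h1 := (norm_wp_lt_one hh hlt ρ).le
    have h2 := norm_nonneg (coeff (ρ : ZetaZeros.riemannZetaNontrivialZeros))
    show ‖coeff (ρ : ZetaZeros.riemannZetaNontrivialZeros)‖ * ‖wp h ρ‖ / 2 ≤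
      ‖coeff (ρ : ZetaZeros.riemannZetaNontrivialZeros)‖
    nlinarith
  -- THE RIGIDITY THEOREM: the fibre of `a` carries zero charge
  have key := cluster_charge_eq_zero (ι := topSet δ) (w := fun ρ ↦ wp h ρ)
    (b := fun ρ ↦ coeff ρ * wp h ρ / 2) (ρ₀ := Real.exp (-(δ * h)))
    (g := fun w ↦ Hfun h δ ((rstar h : ℂ) / w)) (c₀ := ∑' ρ : topSet δ, coeff ρ / 2)
    (Real.exp_pos _).le (fun ρ ↦ norm_wp_lt_one hh hlt ρ) (summable_one_sub_norm_wp hh hlt hBL) hb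
    (differentiableOn_g hh hδΘ hceil') (fun w hw ↦ hasSum_g hh hδ.le hδΘ hlt hceil' hw) ha ha1
  -- on the fibre, `b_ρ = (a/2) c_ρ`
  have e : (fun i : {i : topSet δ // wp h i = a} ↦
      coeff ((i : topSet δ) : ZetaZeros.riemannZetaNontrivialZeros) * wp h i / 2) =
      fun i : {i : topSet δ // wp h i = a} ↦
        a / 2 * coeff ((i : topSet δ) : ZetaZeros.riemannZetaNontrivialZeros) := by
    funext i
    rw [i.2]
    ring
  rw [e, tsum_mul_left] at key
  have hS : ∑' i : {i : topSet δ // wp h i = a},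
      coeff ((i : topSet δ) : ZetaZeros.riemannZetaNontrivialZeros) = 0 := by
    rcases mul_eq_zero.1 key with h0 | h0
    · exact absurd h0 (div_ne_zero ha0 two_ne_zero)
    · exact h0
  -- but the fibre sum has negative real part
  have hsum : Summable fun i : {i : topSet δ // wp h i = a} ↦
      coeff ((i : topSet δ) : ZetaZeros.riemannZetaNontrivialZeros) :=
    Summable.of_norm ((summable_norm_coeff.subtype (topSet δ)).subtype _)
  have hre : (∑' i : {i : topSet δ // wp h i = a},
      coeff ((i : topSet δ) : ZetaZeros.riemannZetaNontrivialZeros)).re =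
      ∑' i : {i : topSet δ // wp h i = a},
        (coeff ((i : topSet δ) : ZetaZeros.riemannZetaNontrivialZeros)).re := Complex.re_tsum hsum
  have hneg : Summable fun i : {i : topSet δ // wp h i = a} ↦
      -(coeff ((i : topSet δ) : ZetaZeros.riemannZetaNontrivialZeros)).re :=
    (Complex.hasSum_re hsum.hasSum).summable.neg
  set i₁ : {i : topSet δ // wp h i = a} := ⟨ρ₁', rfl⟩ with hi₁
  have hle := hneg.le_tsum i₁ (fun j _ ↦ by
    have := re_coeff_neg ((j : topSet δ) : ZetaZeros.riemannZetaNontrivialZeros)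
    linarith)
  rw [tsum_neg] at hle
  have hlt₁ := re_coeff_neg ((i₁ : topSet δ) : ZetaZeros.riemannZetaNontrivialZeros)
  rw [← hre, hS, Complex.zero_re] at hle
  linarith

/-- **ROW X-BL, unconditional** (`h > 0`): `CEIL(h) ∧ TBL ⟺ RH`. -/
theorem latticeCeiling_and_topBlaschke_iff_rh {h : ℝ} (hh : 0 < h) :
    ((∀ ε : ℝ, 0 < ε → ∃ K : ℝ, ∀ k : ℕ, |zetaScrew (k * h)| ≤ K * Real.exp (ε * k)) ∧
      TopBlaschke) ↔ RiemannHypothesis :=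
  latticeCeiling_and_topBlaschke_iff_rh_of hh (blaschkeTransparency hh)

/-- **ROW X-BL, disjunctive form** (`h > 0`): `CEIL(h) ∧ (MaxRe ∨ TBL) ⟺ RH` — the supremal abscissa is
attained OR approached Blaschke-summably. -/
theorem latticeCeiling_and_maxRe_or_topBlaschke_iff_rh {h : ℝ} (hh : 0 < h) :
    ((∀ ε : ℝ, 0 < ε → ∃ K : ℝ, ∀ k : ℕ, |zetaScrew (k * h)| ≤ K * Real.exp (ε * k)) ∧
      ((∃ ρ₀ : ℂ, ρ₀ ∈ ZetaZeros.riemannZetaNontrivialZeros ∧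
          ∀ ρ : ℂ, ρ ∈ ZetaZeros.riemannZetaNontrivialZeros → ρ.re ≤ ρ₀.re) ∨ TopBlaschke)) ↔
      RiemannHypothesis :=
  latticeCeiling_and_maxRe_or_topBlaschke_iff_rh_of hh (blaschkeTransparency hh)

/-- **NON-BLASCHKE RESIDUE** (RH-free reading, `h > 0`): under `CEIL(h)` and `¬RH`, NO top band is
Blaschke — `∑_{Θ-δ<Re ρ<Θ} (Θ - Re ρ) = ∞` for every `δ > 0`. -/
theorem nonBlaschkeResidue {h : ℝ} (hh : 0 < h) : NonBlaschkeResidue h :=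
  (nonBlaschkeResidue_iff h).2 (blaschkeTransparency hh)

/-- **STRUCTURE OF THE RESIDUE, Blaschke form** (`h > 0`, RH-free): under `CEIL(h)` either RH holds, or
`Θ > 1/2` is not attained AND every top band has divergent total depth. -/
theorem latticeCeiling_dichotomy_nonBlaschke {h : ℝ} (hh : 0 < h)
    (hceil : ∀ ε : ℝ, 0 < ε → ∃ K : ℝ, ∀ k : ℕ, |zetaScrew (k * h)| ≤ K * Real.exp (ε * k)) :
    RiemannHypothesis ∨
      (1 / 2 < supRe ∧ (∀ ρ : ℂ, ρ ∈ ZetaZeros.riemannZetaNontrivialZeros → ρ.re < supRe) ∧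
        ∀ δ : ℝ, 0 < δ → ¬ BlaschkeTop δ) := by
  rcases latticeCeiling_dichotomy_top hh hceil with hRH | ⟨hΘ, hlt, -⟩
  · exact Or.inl hRH
  · by_cases hRH : RiemannHypothesis
    · exact Or.inl hRH
    · exact Or.inr ⟨hΘ, hlt, fun δ hδ ↦ nonBlaschkeResidue hh hceil hRH δ hδ⟩

end Summit.RiemannHypothesis.RiemannHypothesis.Theorems.Splittings.ScrewBlaschkeSeam
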